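import Literature.Topology.FourManifolds.CorkDecompositionMatveyevForm
import Literature.Topology.FourManifolds.HCobordismLowHandlesTwoLeaves
import HarnessLib

/-!
# The cork decomposition theorem from the frontier of its DAG (discharge file of `CorkTwist.lean`)

Topic `Literature/Topology/FourManifolds` (fact seat
`provefact-Literature.Topology.FourManifolds.corkDecomposition`, sibling "Proofs" file of
`CorkTwist.lean`, which states the named fact `Literature.Topology.FourManifolds.corkDecomposition`:
Matveyev, *A decomposition of smooth simply-connected h-cobordant 4-manifolds*, J. Differential
Geom. 44 (1996) 571–582, arXiv:dg-ga/9505001, Theorem 1 parts 1–2 minus the `H₂` clause, in the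
one-piece form; Curtis–Freedman–Hsiang–Stong, Invent. Math. 123 (1996) 343–348, Theorem).

The tree proves the cork decomposition theorem *down to named-fact leaves* along the printed
proof (Matveyev pp. 1–3; Kirby, Turkish J. Math. 20 (1996), §§2–4): the top of the DAG is
`Literature.Topology.FourManifolds.corkDecomposition_of_middleLevel` (`CorkDecompositionMiddleLevel.lean`), whose four
hypotheses are Milnor's Thm. 8.1 at one end of the 5-dimensional h-cobordism, Thm. 4.4 on a
slab, the middle level of the two-three handlebody (B) and the four-dimensional construction in
the middle level (H4).  Since that file landed, Thm. 4.4 on a slab has been **discharged**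
(`Cobordism.Milnor1965_exists_isGradientLike_disjoint_spheres_slab_holds`, `DisjointSpheresSlab.lean`)
and Thm. 8.1 at one end has been reduced to the **two** leaves of Milnor's proof that are still
named facts (`Cobordism.Milnor1965_exists_isMorseFunction_two_le_index_left_of_two_leaves`,
`HCobordismLowHandlesTwoLeaves.lean`).  This file records the resulting assembly, i.e. states the
cork decomposition theorem (and Matveyev's printed two-piece form
`Literature.Topology.FourManifolds.Matveyev1996_decomposition`) as a consequence of exactly the
**four named facts that remain open below it** (the frontier, 2026-08-15):

| leaf | source | tree name |
|---|---|---|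
| L3 | Milnor 1965, Thm. 5.4, Assertion 6 | `Cobordism.Milnor1965_cancellation_preliminaryHypothesis` (`HCobordismFirstCancellation.lean`) |
| L8 | Milnor 1965, Lemma 8.3 in `V₂₊` | `Cobordism.Milnor1965_exists_idealCircle` (`HCobordismAuxiliaryPair.lean`) |
| (B) | Kirby 1996 §2 (last par.); Matveyev, Proof of Theorem, sentences 1–6 | `exists_dualSpheres_middleLevel_of_two_three` (`CorkDecompositionMiddleLevel.lean`) |
| (H4) | Matveyev pp. 1–3 with Fact 1; Kirby 1996 §3, Addenda (B), (C) | `Matveyev1996_partOne_and_fact_of_dualSpheres` (`CorkDecompositionMiddleLevel.lean`) |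

* `Literature.Topology.FourManifolds.corkDecomposition_of_frontier` — `corkDecomposition ⟸ L3 ∧ L8 ∧ (B) ∧ (H4)`;
* `Literature.Topology.FourManifolds.matveyev1996_decomposition_of_frontier` — the printed form from the same four leaves.

When the four leaves are discharged, `corkDecomposition_holds` is `corkDecomposition_of_frontier`
applied to the four `_holds`, to be appended here.  No statement is introduced in this file.

## References

* R. Matveyev, *A decomposition of smooth simply-connected h-cobordant 4-manifolds*,
  J. Differential Geom. 44 (1996) 571–582; arXiv:dg-ga/9505001: Theorem 1 (p. 1), Proof of
  Theorem (pp. 1–2), Fact 1 (p. 3). [Matveyev1996]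
* C. L. Curtis, M. H. Freedman, W.-C. Hsiang, R. Stong, *A decomposition theorem for h-cobordant
  smooth simply-connected compact 4-manifolds*, Invent. Math. 123 (1996) 343–348, Theorem.
  [CurtisFreedmanHsiangStong1996]
* R. Kirby, *Akbulut's corks and h-cobordisms of smooth, simply connected 4-manifolds*, Turkish
  J. Math. 20 (1996) 85–93; arXiv:math/9712231, §§2–4. [KirbyCorks1996]
* J. Milnor, *Lectures on the h-cobordism theorem*, Princeton (1965): Thm. 4.4, Thm. 5.4
  (Assertion 6), Lemma 8.3, Thm. 8.1 and its proof (PDF pp. 54–57). [MilnorHCobordism1965]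
-/

noncomputable section

namespace Literature.Topology.FourManifolds

universe u

/-- **The cork decomposition theorem from the frontier of its DAG.**
`Literature.Topology.FourManifolds.corkDecomposition` (h-cobordant simply connected closed smooth 4-manifolds
differ by a cork twist along a compact contractible `C`; Matveyev 1996, Theorem 1;
Curtis–Freedman–Hsiang–Stong 1996) follows from the four named facts still open below it:
Assertion 6 of the proof of Milnor's First Cancellation Theorem 5.4 (L3), Milnor's Lemma 8.3
in `V₂₊` (L8) — which give Thm. 8.1 at one end of the h-cobordism by
`Cobordism.Milnor1965_exists_isMorseFunction_two_le_index_left_of_two_leaves` —, the middle level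
of the two-three handlebody (B) and the four-dimensional construction from the middle level on
(H4); by `corkDecomposition_of_middleLevel` with Thm. 4.4 on a slab discharged
(`Cobordism.Milnor1965_exists_isGradientLike_disjoint_spheres_slab_holds`).
[cite: Matveyev1996, Theorem 1 and its proof (arXiv pp. 1–3)]
[cite: KirbyCorks1996, §§2–4: Theorem and Addenda (B), (C)]
[cite: MilnorHCobordism1965, Thm. 5.4 Assertion 6, Lemma 8.3, Thm. 8.1 (PDF pp. 27–35, 54–57)] -/
theorem corkDecomposition_of_frontier
    (h6 : Cobordism.Milnor1965_cancellation_preliminaryHypothesis.{u})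
    (hA : Cobordism.Milnor1965_exists_idealCircle.{u})
    (hB : exists_dualSpheres_middleLevel_of_two_three.{u})
    (h4 : Matveyev1996_partOne_and_fact_of_dualSpheres.{u}) : corkDecomposition.{u} :=
  corkDecomposition_of_middleLevel
    (Cobordism.Milnor1965_exists_isMorseFunction_two_le_index_left_of_two_leaves h6 hA)
    Cobordism.Milnor1965_exists_isGradientLike_disjoint_spheres_slab_holds hB h4

/-- **Matveyev's Theorem 1, parts 1–2 minus the `H₂` clause (printed two-piece form), from the
same frontier**: `Literature.Topology.FourManifolds.Matveyev1996_decomposition` from L3, L8, (B) and (H4), by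
`matveyev1996_decomposition_of_middleLevel` (`CorkDecompositionMatveyevForm.lean`) with Thm. 8.1
at one end supplied by `Cobordism.Milnor1965_exists_isMorseFunction_two_le_index_left_of_two_leaves`.
[cite: Matveyev1996, Theorem 1 and its proof (arXiv pp. 1–3)]
[cite: MilnorHCobordism1965, Thm. 5.4 Assertion 6, Lemma 8.3, Thm. 8.1 (PDF pp. 27–35, 54–57)] -/
theorem matveyev1996_decomposition_of_frontier
    (h6 : Cobordism.Milnor1965_cancellation_preliminaryHypothesis.{u})
    (hA : Cobordism.Milnor1965_exists_idealCircle.{u})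
    (hB : exists_dualSpheres_middleLevel_of_two_three.{u})
    (h4 : Matveyev1996_partOne_and_fact_of_dualSpheres.{u}) : Matveyev1996_decomposition.{u} :=
  matveyev1996_decomposition_of_middleLevel
    (Cobordism.Milnor1965_exists_isMorseFunction_two_le_index_left_of_two_leaves h6 hA) hB h4

end Literature.Topology.FourManifolds

end
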